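import Summits.ValiantsHypothesis.ValiantsHypothesis.Theses.UnpaddedGIT
import Summits.ValiantsHypothesis.ValiantsHypothesis.Theses.RigidityForcesSymmetry
import Summits.ValiantsHypothesis.ValiantsHypothesis.Theorems.RigidityForcesSymmetryGrenetBoundToVH
import Literature.Computability.AlgebraicComplexity.EquivariantDC

/-!
# Birth skeleton — piece `TorusEquivariantBorderQP` (child-to-be of `UnpaddedGIT.InvariantSeparationQP`,
strategist split v2, planner-cstrat-stmt-ValiantsHypothesis-5758-r1-0, 2026-08-17)

Border torus-equivariant lower bound = EXACT torus count (`RigidityForcesSymmetry.TorusBound`,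
open crux stmt-ValiantsHypothesis-4164, stated verbatim so that closing it closes the stub) +
EQUIVARIANT DE-BORDERING for the permanent in the torus model (qp loss), glued by the tree's
growth lemma `eventually_two_pow_qpExp_lt` (`2^((log₂ n + c)^c) < 2^n - 1` eventually).
Sorries only in the two `stub_*`; `TorusEquivariantBorderQP_of` is a real proof.
-/

set_option linter.dupNamespace false

namespace Summit.ValiantsHypothesis.ValiantsHypothesis.Cruxes.InvariantSeparationQP.Split

open Literature.Computability.AlgebraicComplexity

/-- The piece, verbatim (it becomes `Theses.UnpaddedGIT.TorusEquivariantBorderQP` on `--split`). -/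
def TorusEquivariantBorderQP : Prop :=
  ∀ c : ℕ, ∃ n₀ : ℕ, ∀ n ≥ n₀, ∀ m : ℕ, m ≤ 2 ^ ((Nat.log 2 n + c) ^ c) → Literature.Computability.AlgebraicComplexity.coeffVec (Literature.Computability.AlgebraicComplexity.perPoly (Fin n) ℂ) ∉ Literature.Computability.AlgebraicComplexity.zariskiClosure (Literature.Computability.AlgebraicComplexity.coeffVec '' {g : MvPolynomial (Fin n × Fin n) ℂ | Literature.Computability.AlgebraicComplexity.HasEquivariantDetRepr (Subgroup.closure {γ : Matrix.GeneralLinearGroup (Fin n × Fin n) ℂ | ∃ d e : Fin n → ℂ, (γ : Matrix (Fin n × Fin n) (Fin n × Fin n) ℂ) = Matrix.diagonal (fun p => d p.1 * e p.2)}) g m})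

/-- **stub_torusDeborder** — equivariant de-bordering for the permanent in the torus model, with
quasi-polynomial loss: if `per_n` is a limit of polynomials with torus-equivariant affine
determinantal representations of size `m ≤ qp(n)` then `per_n` itself has one of size `qp₁(n)`.
Why plausibly true: torus lifts give a `ℤ^{2n}`-grading; graded (ROABP/Nisan-type) models have
CLOSED rank characterisations, so flat/torus-fixed limits of graded witnesses stay graded of
comparable size. Size: L. -/
theorem stub_torusDeborder :
    ∀ c : ℕ, ∃ c₁ n₀ : ℕ, ∀ n ≥ n₀, ∀ m : ℕ, m ≤ 2 ^ ((Nat.log 2 n + c) ^ c) →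
      coeffVec (perPoly (Fin n) ℂ) ∈ zariskiClosure (coeffVec ''
        {g : MvPolynomial (Fin n × Fin n) ℂ | HasEquivariantDetRepr
          (Subgroup.closure {γ : Matrix.GeneralLinearGroup (Fin n × Fin n) ℂ | ∃ d e : Fin n → ℂ,
            (γ : Matrix (Fin n × Fin n) (Fin n × Fin n) ℂ) = Matrix.diagonal (fun p => d p.1 * e p.2)}) g m}) →
      ∃ m₁ : ℕ, m₁ ≤ 2 ^ ((Nat.log 2 n + c₁) ^ c₁) ∧
        HasEquivariantDetRepr
          (Subgroup.closure {γ : Matrix.GeneralLinearGroup (Fin n × Fin n) ℂ | ∃ d e : Fin n → ℂ,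
            (γ : Matrix (Fin n × Fin n) (Fin n × Fin n) ℂ) = Matrix.diagonal (fun p => d p.1 * e p.2)})
          (perPoly (Fin n) ℂ) m₁ := by
  sorry

/-- **stub_torusBound** — the exact two-sided torus count, VERBATIM the open crux
`RigidityForcesSymmetry.TorusBound` (stmt-ValiantsHypothesis-4164; its (S,T)-graded-ABP sketch:
regularity by von zur Gathen ⇒ Λ = 0 ⊕ I ⇒ grading by one generic lifted torus element ⇒ ≥ C(n,d)
vertices at depth d ⇒ ≥ 2^n − 1). Size: L. -/
theorem stub_torusBound : Theses.RigidityForcesSymmetry.TorusBound := by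
  sorry

/-- **Composition (real proof).** De-bordering turns a border witness of size `≤ qp_c(n)` into an
exact torus-equivariant representation of `per_n` of size `m₁ ≤ qp_{c₁}(n)`; the exact count gives
`2^n - 1 ≤ m₁`; and `qp_{c₁}(n) < 2^n - 1` eventually (`eventually_two_pow_qpExp_lt`). -/
theorem TorusEquivariantBorderQP_of
    (hD : ∀ c : ℕ, ∃ c₁ n₀ : ℕ, ∀ n ≥ n₀, ∀ m : ℕ, m ≤ 2 ^ ((Nat.log 2 n + c) ^ c) →
      coeffVec (perPoly (Fin n) ℂ) ∈ zariskiClosure (coeffVec ''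
        {g : MvPolynomial (Fin n × Fin n) ℂ | HasEquivariantDetRepr
          (Subgroup.closure {γ : Matrix.GeneralLinearGroup (Fin n × Fin n) ℂ | ∃ d e : Fin n → ℂ,
            (γ : Matrix (Fin n × Fin n) (Fin n × Fin n) ℂ) = Matrix.diagonal (fun p => d p.1 * e p.2)}) g m}) →
      ∃ m₁ : ℕ, m₁ ≤ 2 ^ ((Nat.log 2 n + c₁) ^ c₁) ∧
        HasEquivariantDetRepr
          (Subgroup.closure {γ : Matrix.GeneralLinearGroup (Fin n × Fin n) ℂ | ∃ d e : Fin n → ℂ,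
            (γ : Matrix (Fin n × Fin n) (Fin n × Fin n) ℂ) = Matrix.diagonal (fun p => d p.1 * e p.2)})
          (perPoly (Fin n) ℂ) m₁)
    (hTB : Theses.RigidityForcesSymmetry.TorusBound) :
    TorusEquivariantBorderQP := by
  intro c
  obtain ⟨c₁, n₁, h₁⟩ := hD c
  obtain ⟨N, hN⟩ := Theorems.RigidityForcesSymmetryGrenetBoundToVH.eventually_two_pow_qpExp_lt c₁
  refine ⟨max (max n₁ N) 3, fun n hn m hm hmem => ?_⟩
  have hn₁ : n₁ ≤ n := le_trans (le_trans (le_max_left _ _) (le_max_left _ _)) hn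
  have hN' : N ≤ n := le_trans (le_trans (le_max_right _ _) (le_max_left _ _)) hn
  have h3 : 3 ≤ n := le_trans (le_max_right _ _) hn
  obtain ⟨m₁, hm₁, A, hA⟩ := h₁ n hn₁ m hm hmem
  have hcount : 2 ^ n - 1 ≤ m₁ := hTB n h3 m₁ A hA
  have hlt : 2 ^ ((Nat.log 2 n + c₁) ^ c₁) < 2 ^ n - 1 := hN n hN'
  omega

end Summit.ValiantsHypothesis.ValiantsHypothesis.Cruxes.InvariantSeparationQP.Split
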